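import Literature.Topology.FourManifolds.LinkTubularUniqueness
import HarnessLib

/-!
# Tubes around a circle in a 3-manifold: the transition map of two tubes with the same core,
# its fibre derivative and its orthogonal frame

Topic `Literature/Topology/FourManifolds`; infrastructure for the uniqueness of tubular
neighbourhoods of a circle **in an arbitrary 3-manifold** (Kosinski, *Differential Manifolds*
(1993), III (3.1), (3.5)), needed by the isotopy invariance of 2-handle attachment
(`Geometry/Symplectic/TwoHandleIsotopy.lean`: the two tubes are the sphere parts of two attaching
maps of 2-handles with the same attaching circle, read in the boundary 3-manifold `∂W`).  The
tree's `LinkTubularUniqueness.lean` carries out Kosinski's argument for tubular neighbourhoods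
`S¹ × ℝ² ↪ S³` of a link in `S³` (`Knot.TubularNbhd`, all of `S³` in one stereographic chart);
this file redoes its first two paragraphs for **tubes** in any `Y`:

* `CircleTube Y` — an open partial homeomorphism `Φ : S¹ × ℝ² ⇀ Y` with source the unit tube
  `S¹ × B(0, 1)`, `C^∞` with `C^∞` inverse (the shape produced by `exists_framedTube`,
  `FramedCircleTube.lean`, and by the sphere part of an attaching map); its core
  `Φ.core θ = Φ (θ, 0)`; the differentials of `Φ` and `Φ⁻¹` are injective
  (`injective_mfderiv_toHomeo`, `injective_mfderiv_symm`);
* for two tubes `Φ₁`, `Φ₂` with the same core: the **transition map** `τ = Φ₂⁻¹ ∘ Φ₁`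
  (`CircleTube.transition`), smooth near the zero section which it fixes pointwise, with
  injective differential there, block triangular `Dτ(x,0)(ξ, v) = (ξ + βv, A(x) v)`
  (`mfderiv_transition_snd`, `mfderiv_transition_horizontal`); the **fibre derivative**
  `A(x)` (`CircleTube.fibreDeriv`), invertible and smooth in `x`;
* the **orthogonal frame** of `A` (`CircleTube.tubeFrame`): `u(x) = A(x)e₀/‖A(x)e₀‖`,
  `Q(x) = [u(x), s J u(x)]` with the constant sign `s = ±1` of `det A` (`exists_frameSign`: the
  orientation function `⟪A e₁, J u⟫` is continuous and nowhere zero on the connected `S¹`), a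
  smooth family of linear isometries with `(1 - t) A(x) + t Q(x)` injective for `0 ≤ t ≤ 1`
  (`injective_line_tubeFrame`, from the tree's `injective_lineToFrame`).

Unlike `Knot.TubularNbhd` no orientation convention is imposed, so `Q(x)` may contain the
reflection `s = -1`; downstream this reflection is absorbed by a symmetry of the model handle.
Everything here is proved; the only definitions are the structure `CircleTube` and the named
constructions above; no named fact is introduced.

## References

* A. A. Kosinski, *Differential Manifolds*, Academic Press (1993), III (3.1), (3.5). [Kosinski1993]
* M. W. Hirsch, *Differential Topology*, GTM 33 (1976), Ch. 4 §5, Thm. 5.3. [HirschDT1976]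
-/

noncomputable section

open Set Function Metric Filter
open scoped Manifold ContDiff Topology RealInnerProductSpace

namespace Literature.Topology.FourManifolds

/-- Local notation: `𝔼 n` is the model Euclidean space `EuclideanSpace ℝ (Fin n)`. -/
local notation "𝔼 " n:arg => EuclideanSpace ℝ (Fin n)

/-- Local notation: `𝕊 n` is the unit sphere in `EuclideanSpace ℝ (Fin (n + 1))`. -/
local notation "𝕊 " n:arg => (Metric.sphere (0 : EuclideanSpace ℝ (Fin (n + 1))) 1)

/-- Local notation: the model with corners of the tube `S¹ × ℝ²`. -/
local notation "I𝕋₁" => (ModelWithCorners.prod (𝓡 1) 𝓘(ℝ, EuclideanSpace ℝ (Fin 2)))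

attribute [local instance] fact_finrank_euclideanSpace_two

/-! ### Tubes around a circle -/

/-- **A tube around a circle in a 3-manifold `Y`**: an open partial homeomorphism
`Φ : S¹ × ℝ² ⇀ Y` with source the unit tube `S¹ × B(0, 1)`, `C^∞` on its source with `C^∞`
inverse on its (open) target.  Its core is the embedded circle `θ ↦ Φ (θ, 0)`.  (Kosinski 1993,
III §1–3: a tubular neighbourhood of the circle, here without orientation convention.)
[cite: Kosinski1993, III (3.1)] -/
structure CircleTube (Y : Type*) [TopologicalSpace Y] [ChartedSpace (𝔼 3) Y] where
  /-- the tube map, as a partial homeomorphism -/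
  toHomeo : OpenPartialHomeomorph ((𝕊 1) × 𝔼 2) Y
  /-- the source is the unit tube -/
  source_eq : toHomeo.source = (univ : Set (𝕊 1)) ×ˢ ball (0 : 𝔼 2) 1
  /-- the tube map is smooth on its source -/
  contMDiffOn_toHomeo : ContMDiffOn I𝕋₁ (𝓡 3) ∞ toHomeo toHomeo.source
  /-- the inverse is smooth on the target -/
  contMDiffOn_symm : ContMDiffOn (𝓡 3) I𝕋₁ ∞ toHomeo.symm toHomeo.target

namespace CircleTube

variable {Y : Type*} [TopologicalSpace Y] [ChartedSpace (𝔼 3) Y] (Φ : CircleTube Y)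

/-- Membership in the source: `(θ, w) ∈ source ↔ ‖w‖ < 1`. [folklore] -/
theorem mem_source_iff {θ : 𝕊 1} {w : 𝔼 2} : (θ, w) ∈ Φ.toHomeo.source ↔ ‖w‖ < 1 := by
  rw [Φ.source_eq, mem_prod, mem_ball_zero_iff]
  exact ⟨fun h => h.2, fun h => ⟨mem_univ _, h⟩⟩

/-- The zero section lies in the source. [folklore] -/
theorem mem_source_zero (θ : 𝕊 1) : ((θ, (0 : 𝔼 2)) : (𝕊 1) × 𝔼 2) ∈ Φ.toHomeo.source :=
  Φ.mem_source_iff.2 (by simp)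

/-- The source is open. [folklore] -/
theorem isOpen_source : IsOpen Φ.toHomeo.source := Φ.toHomeo.open_source

/-- **The core** `θ ↦ Φ (θ, 0)` of the tube. [cite: Kosinski1993, III (3.1)] -/
def core (θ : 𝕊 1) : Y := Φ.toHomeo (θ, 0)

/-- Unfolding the core. [folklore] -/
@[simp] theorem core_apply (θ : 𝕊 1) : Φ.core θ = Φ.toHomeo (θ, 0) := rfl

/-- The core lies in the target. [folklore] -/
theorem core_mem_target (θ : 𝕊 1) : Φ.core θ ∈ Φ.toHomeo.target :=
  Φ.toHomeo.map_source (Φ.mem_source_zero θ)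

/-- `Φ⁻¹ (Φ q) = q` on the source. [folklore] -/
theorem symm_apply_apply {q : (𝕊 1) × 𝔼 2} (hq : q ∈ Φ.toHomeo.source) :
    Φ.toHomeo.symm (Φ.toHomeo q) = q :=
  Φ.toHomeo.left_inv hq

/-- `Φ (Φ⁻¹ p) = p` on the target. [folklore] -/
theorem apply_symm_apply {p : Y} (hp : p ∈ Φ.toHomeo.target) : Φ.toHomeo (Φ.toHomeo.symm p) = p :=
  Φ.toHomeo.right_inv hp

/-- `Φ⁻¹` of a core point. [folklore] -/
@[simp] theorem symm_core (θ : 𝕊 1) : Φ.toHomeo.symm (Φ.core θ) = (θ, 0) :=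
  Φ.symm_apply_apply (Φ.mem_source_zero θ)

/-- The tube map is `C^∞` at the points of the source. [folklore] -/
theorem contMDiffAt_toHomeo {q : (𝕊 1) × 𝔼 2} (hq : q ∈ Φ.toHomeo.source) :
    ContMDiffAt I𝕋₁ (𝓡 3) ∞ Φ.toHomeo q :=
  Φ.contMDiffOn_toHomeo.contMDiffAt (Φ.isOpen_source.mem_nhds hq)

/-- The inverse is `C^∞` at the points of the target. [folklore] -/
theorem contMDiffAt_symm {p : Y} (hp : p ∈ Φ.toHomeo.target) :
    ContMDiffAt (𝓡 3) I𝕋₁ ∞ Φ.toHomeo.symm p :=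
  Φ.contMDiffOn_symm.contMDiffAt (Φ.toHomeo.open_target.mem_nhds hp)

/-- The core is smooth. [folklore] -/
theorem contMDiff_core : ContMDiff (𝓡 1) (𝓡 3) ∞ Φ.core := fun θ =>
  (Φ.contMDiffAt_toHomeo (Φ.mem_source_zero θ)).comp θ (contMDiffAt_id.prodMk contMDiffAt_const)

/-- The core is injective. [folklore] -/
theorem injective_core : Injective Φ.core := fun θ θ' h => by
  have := Φ.toHomeo.injOn (Φ.mem_source_zero θ) (Φ.mem_source_zero θ') h
  exact congrArg Prod.fst this

/-- `Φ ∘ Φ⁻¹ = id` near every point of the (open) target. [folklore] -/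
theorem toHomeo_symm_eventuallyEq {p : Y} (hp : p ∈ Φ.toHomeo.target) :
    (Φ.toHomeo ∘ Φ.toHomeo.symm) =ᶠ[𝓝 p] id := by
  filter_upwards [Φ.toHomeo.open_target.mem_nhds hp] with p' hp'
  exact Φ.apply_symm_apply hp'

/-- **The differential of a tube map is injective** on the source (it has the smooth left
inverse `Φ⁻¹`). [folklore] -/
theorem injective_mfderiv_toHomeo {q : (𝕊 1) × 𝔼 2} (hq : q ∈ Φ.toHomeo.source) :
    Injective (mfderiv I𝕋₁ (𝓡 3) Φ.toHomeo q) := by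
  have h1 : HasMFDerivAt I𝕋₁ (𝓡 3) Φ.toHomeo q (mfderiv I𝕋₁ (𝓡 3) Φ.toHomeo q) :=
    ((Φ.contMDiffAt_toHomeo hq).mdifferentiableAt (by simp)).hasMFDerivAt
  have h2 : HasMFDerivAt (𝓡 3) I𝕋₁ Φ.toHomeo.symm (Φ.toHomeo q)
      (mfderiv (𝓡 3) I𝕋₁ Φ.toHomeo.symm (Φ.toHomeo q)) :=
    ((Φ.contMDiffAt_symm (Φ.toHomeo.map_source hq)).mdifferentiableAt (by simp)).hasMFDerivAt
  have hev : (id : (𝕊 1) × 𝔼 2 → (𝕊 1) × 𝔼 2) =ᶠ[𝓝 q] (Φ.toHomeo.symm ∘ Φ.toHomeo) := by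
    filter_upwards [Φ.isOpen_source.mem_nhds hq] with q' hq'
    exact (Φ.symm_apply_apply hq').symm
  have hc := (h2.comp q h1).congr_of_eventuallyEq hev
  have heq := (hasMFDerivAt_id (I := I𝕋₁) q).mfderiv ▸ hc.mfderiv
  have key : ∀ w, mfderiv (𝓡 3) I𝕋₁ Φ.toHomeo.symm (Φ.toHomeo q)
      (mfderiv I𝕋₁ (𝓡 3) Φ.toHomeo q w) = w :=
    fun w => ((ContinuousLinearMap.ext_iff.1 heq) w).symm
  exact Function.LeftInverse.injective key

/-- **The differential of `Φ⁻¹` is injective** at the points of the target. [folklore] -/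
theorem injective_mfderiv_symm {p : Y} (hp : p ∈ Φ.toHomeo.target) :
    Injective (mfderiv (𝓡 3) I𝕋₁ Φ.toHomeo.symm p) := by
  have h2 : HasMFDerivAt (𝓡 3) I𝕋₁ Φ.toHomeo.symm p (mfderiv (𝓡 3) I𝕋₁ Φ.toHomeo.symm p) :=
    ((Φ.contMDiffAt_symm hp).mdifferentiableAt (by simp)).hasMFDerivAt
  have h1 : HasMFDerivAt I𝕋₁ (𝓡 3) Φ.toHomeo (Φ.toHomeo.symm p)
      (mfderiv I𝕋₁ (𝓡 3) Φ.toHomeo (Φ.toHomeo.symm p)) :=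
    ((Φ.contMDiffAt_toHomeo (Φ.toHomeo.map_target hp)).mdifferentiableAt (by simp)).hasMFDerivAt
  have hc := (h1.comp p h2).congr_of_eventuallyEq (Φ.toHomeo_symm_eventuallyEq hp).symm
  have heq := (hasMFDerivAt_id (I := 𝓡 3) p).mfderiv ▸ hc.mfderiv
  have key : ∀ w, mfderiv I𝕋₁ (𝓡 3) Φ.toHomeo (Φ.toHomeo.symm p)
      (mfderiv (𝓡 3) I𝕋₁ Φ.toHomeo.symm p w) = w :=
    fun w => ((ContinuousLinearMap.ext_iff.1 heq) w).symm
  exact Function.LeftInverse.injective key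

/-! ### The transition map of two tubes with the same core -/

section Transition

variable (Φ₁ Φ₂ : CircleTube Y)

/-- The **transition map** `τ = Φ₂⁻¹ ∘ Φ₁` of two tubes (defined everywhere, meaningful on the
domain `transitionDom`); Kosinski (1993), III §3. [cite: Kosinski1993, III (3.1)] -/
def transition : (𝕊 1) × 𝔼 2 → (𝕊 1) × 𝔼 2 := Φ₂.toHomeo.symm ∘ Φ₁.toHomeo

/-- The domain `source₁ ∩ Φ₁⁻¹(target₂)` of the transition map. [folklore] -/
def transitionDom : Set ((𝕊 1) × 𝔼 2) := Φ₁.toHomeo.source ∩ Φ₁.toHomeo ⁻¹' Φ₂.toHomeo.target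

/-- The domain of the transition map is open. [folklore] -/
theorem isOpen_transitionDom : IsOpen (transitionDom Φ₁ Φ₂) :=
  Φ₁.toHomeo.continuousOn.isOpen_inter_preimage Φ₁.isOpen_source Φ₂.toHomeo.open_target

variable {Φ₁ Φ₂} (hcore : ∀ θ, Φ₁.core θ = Φ₂.core θ)

include hcore in
/-- The zero section lies in the domain of the transition map of two tubes with the same core.
[folklore] -/
theorem mem_transitionDom_zero (x : 𝕊 1) :
    ((x, (0 : 𝔼 2)) : (𝕊 1) × 𝔼 2) ∈ transitionDom Φ₁ Φ₂ := by
  refine ⟨Φ₁.mem_source_zero x, ?_⟩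
  show Φ₁.toHomeo (x, 0) ∈ Φ₂.toHomeo.target
  rw [← core_apply, hcore x]
  exact Φ₂.core_mem_target x

include hcore in
/-- The domain of the transition map is a neighbourhood of the zero section. [folklore] -/
theorem transitionDom_mem_nhds_zero (x : 𝕊 1) :
    transitionDom Φ₁ Φ₂ ∈ 𝓝 ((x, (0 : 𝔼 2)) : (𝕊 1) × 𝔼 2) :=
  (isOpen_transitionDom Φ₁ Φ₂).mem_nhds (mem_transitionDom_zero hcore x)

include hcore in
/-- The transition map fixes the zero section pointwise. [folklore] -/
theorem transition_zero (x : 𝕊 1) : transition Φ₁ Φ₂ (x, 0) = (x, 0) := by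
  simp only [transition, comp_apply]
  rw [← core_apply, hcore x, core_apply, Φ₂.symm_apply_apply (Φ₂.mem_source_zero x)]

/-- `Φ₂ ∘ τ = Φ₁` on the domain. [folklore] -/
theorem apply_transition {q : (𝕊 1) × 𝔼 2} (hq : q ∈ transitionDom Φ₁ Φ₂) :
    Φ₂.toHomeo (transition Φ₁ Φ₂ q) = Φ₁.toHomeo q :=
  Φ₂.apply_symm_apply hq.2

/-- The transition map takes the domain into the source of `Φ₂`. [folklore] -/
theorem transition_mem_source {q : (𝕊 1) × 𝔼 2} (hq : q ∈ transitionDom Φ₁ Φ₂) :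
    transition Φ₁ Φ₂ q ∈ Φ₂.toHomeo.source :=
  Φ₂.toHomeo.map_target hq.2

/-- The transition map is `C^∞` on its domain. [folklore] -/
theorem contMDiffAt_transition {q : (𝕊 1) × 𝔼 2} (hq : q ∈ transitionDom Φ₁ Φ₂) :
    ContMDiffAt I𝕋₁ I𝕋₁ ∞ (transition Φ₁ Φ₂) q :=
  (Φ₂.contMDiffAt_symm hq.2).comp q (Φ₁.contMDiffAt_toHomeo hq.1)

/-- The transition map is `C^∞` on its (open) domain. [folklore] -/
theorem contMDiffOn_transition : ContMDiffOn I𝕋₁ I𝕋₁ ∞ (transition Φ₁ Φ₂) (transitionDom Φ₁ Φ₂) :=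
  fun _ hq => (contMDiffAt_transition hq).contMDiffWithinAt

include hcore in
/-- The transition map is differentiable at the points of the zero section. [folklore] -/
theorem mdifferentiableAt_transition (x : 𝕊 1) :
    MDifferentiableAt I𝕋₁ I𝕋₁ (transition Φ₁ Φ₂) (x, 0) :=
  (contMDiffAt_transition (mem_transitionDom_zero hcore x)).mdifferentiableAt (by simp)

include hcore in
/-- **The differential of the transition map is injective** at the zero section. [folklore] -/
theorem injective_mfderiv_transition (x : 𝕊 1) :
    Injective (mfderiv I𝕋₁ I𝕋₁ (transition Φ₁ Φ₂) (x, 0)) := by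
  have hq := mem_transitionDom_zero hcore x
  have h1 := ((Φ₁.contMDiffAt_toHomeo hq.1).mdifferentiableAt (by simp)).hasMFDerivAt
  have h2 := ((Φ₂.contMDiffAt_symm hq.2).mdifferentiableAt (by simp)).hasMFDerivAt
  have hc := h2.comp ((x, (0 : 𝔼 2)) : (𝕊 1) × 𝔼 2) h1
  rw [show Φ₂.toHomeo.symm ∘ Φ₁.toHomeo = transition Φ₁ Φ₂ from rfl] at hc
  rw [hc.mfderiv]
  intro u v huv
  exact Φ₁.injective_mfderiv_toHomeo hq.1 (Φ₂.injective_mfderiv_symm hq.2 huv)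

/-- The **fibre derivative** `A(x) = ∂_w (pr₂ ∘ τ)(x, 0)` of the transition map along the zero
section (Kosinski (1993), III (3.1): the vector bundle map underlying `Φ₂⁻¹ ∘ Φ₁`).
[cite: Kosinski1993, III (3.1)] -/
def fibreDeriv (Φ₁ Φ₂ : CircleTube Y) (x : 𝕊 1) : 𝔼 2 →L[ℝ] 𝔼 2 :=
  fderiv ℝ (fun w : 𝔼 2 => (transition Φ₁ Φ₂ (x, w)).2) 0

include hcore in
/-- The fibre partial map `w ↦ τ (x, w)` is differentiable at `0`. [folklore] -/
theorem mdifferentiableAt_transition_fibre (x : 𝕊 1) :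
    MDifferentiableAt 𝓘(ℝ, 𝔼 2) I𝕋₁ (fun w : 𝔼 2 => transition Φ₁ Φ₂ (x, w)) 0 := by
  have h : ContMDiffAt 𝓘(ℝ, 𝔼 2) I𝕋₁ ∞ (fun w : 𝔼 2 => transition Φ₁ Φ₂ (x, w)) 0 :=
    (contMDiffAt_transition (mem_transitionDom_zero hcore x)).comp 0
      (contMDiffAt_const.prodMk contMDiffAt_id)
  exact h.mdifferentiableAt (by simp)

include hcore in
/-- **Block structure of the differential of the transition map at the zero section**:
`Dτ(x, 0) (ξ, v) = (ξ + β v, A(x) v)` — the second component is the fibre derivative.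
[folklore] -/
theorem mfderiv_transition_snd (x : 𝕊 1) (u : TangentSpace I𝕋₁ ((x, (0 : 𝔼 2)) : (𝕊 1) × 𝔼 2)) :
    (mfderiv I𝕋₁ I𝕋₁ (transition Φ₁ Φ₂) (x, 0) u).2 = fibreDeriv Φ₁ Φ₂ x u.2 := by
  have hτ := mdifferentiableAt_transition hcore x
  have hc := mfderiv_comp ((x, (0 : 𝔼 2)) : (𝕊 1) × 𝔼 2)
    (mdifferentiableAt_snd (I := 𝓡 1) (I' := 𝓘(ℝ, 𝔼 2))) hτ
  rw [mfderiv_snd] at hc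
  have h1 : (mfderiv I𝕋₁ I𝕋₁ (transition Φ₁ Φ₂) (x, 0) u).2 =
      mfderiv I𝕋₁ 𝓘(ℝ, 𝔼 2) (Prod.snd ∘ transition Φ₁ Φ₂) (x, 0) u := by
    rw [hc]; rfl
  have hg : MDifferentiableAt I𝕋₁ 𝓘(ℝ, 𝔼 2) (Prod.snd ∘ transition Φ₁ Φ₂) (x, 0) :=
    (mdifferentiableAt_snd (I := 𝓡 1) (I' := 𝓘(ℝ, 𝔼 2))).comp _ hτ
  have hdec := mfderiv_prod_eq_add_apply (v := u) hg
  have h2 : (fun z : 𝕊 1 =>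
      (Prod.snd ∘ transition Φ₁ Φ₂) (z, ((x, (0 : 𝔼 2)) : (𝕊 1) × 𝔼 2).2)) =
      fun _ => (0 : 𝔼 2) := by
    funext z
    simp [transition_zero hcore]
  rw [h2, mfderiv_const] at hdec
  rw [h1, hdec]
  have h0 : ∀ w : TangentSpace (𝓡 1) x,
      (0 : TangentSpace (𝓡 1) ((x, (0 : 𝔼 2)) : (𝕊 1) × 𝔼 2).1 →L[ℝ]
        TangentSpace 𝓘(ℝ, 𝔼 2) ((Prod.snd ∘ transition Φ₁ Φ₂)
          (((x, (0 : 𝔼 2)) : (𝕊 1) × 𝔼 2).1, ((x, (0 : 𝔼 2)) : (𝕊 1) × 𝔼 2).2))) w = 0 :=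
    fun w => rfl
  erw [h0, zero_add, mfderiv_eq_fderiv]
  rfl

include hcore in
/-- **Block structure of the differential of the transition map at the zero section**:
`Dτ(x, 0) (ξ, 0) = (ξ, 0)` (the zero section is fixed pointwise). [folklore] -/
theorem mfderiv_transition_horizontal (x : 𝕊 1) (ξ : TangentSpace (𝓡 1) x) :
    mfderiv I𝕋₁ I𝕋₁ (transition Φ₁ Φ₂) (x, 0)
      ((ξ, 0) : TangentSpace I𝕋₁ ((x, (0 : 𝔼 2)) : (𝕊 1) × 𝔼 2)) = (ξ, 0) := by
  have h := mfderiv_prod_eq_add_apply (I := 𝓡 1) (I' := 𝓘(ℝ, 𝔼 2)) (I'' := I𝕋₁)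
    (f := transition Φ₁ Φ₂) (p := ((x, (0 : 𝔼 2)) : (𝕊 1) × 𝔼 2))
    (v := ((ξ, 0) : TangentSpace I𝕋₁ ((x, (0 : 𝔼 2)) : (𝕊 1) × 𝔼 2)))
    (mdifferentiableAt_transition hcore x)
  have h2 : (fun z : 𝕊 1 => transition Φ₁ Φ₂ (z, ((x, (0 : 𝔼 2)) : (𝕊 1) × 𝔼 2).2)) =
      fun z => (z, (0 : 𝔼 2)) := by
    funext z; exact transition_zero hcore z
  rw [h2, mfderiv_prod_left] at h
  rw [h]
  erw [map_zero, add_zero]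
  rfl

include hcore in
/-- **The fibre derivative is invertible** (injective): `Dτ(x, 0)` is injective and block
triangular. [folklore] -/
theorem injective_fibreDeriv (x : 𝕊 1) : Injective (fibreDeriv Φ₁ Φ₂ x) := by
  rw [injective_iff_map_eq_zero]
  intro v hv
  set T := mfderiv I𝕋₁ I𝕋₁ (transition Φ₁ Φ₂) (x, 0) with hT
  set u : TangentSpace I𝕋₁ ((x, (0 : 𝔼 2)) : (𝕊 1) × 𝔼 2) := (0, v) with hu
  have h2 : (T u).2 = 0 := by rw [hT, mfderiv_transition_snd hcore, hu, hv]
  have h1 : T u = T (((T u).1, 0) : TangentSpace I𝕋₁ ((x, (0 : 𝔼 2)) : (𝕊 1) × 𝔼 2)) := by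
    rw [hT, mfderiv_transition_horizontal hcore]
    exact Prod.ext rfl h2
  have h3 := injective_mfderiv_transition hcore x h1
  have := congrArg Prod.snd h3
  simpa [hu] using this

include hcore in
/-- **Smoothness of the fibre derivative along the core** (the derivative in the vector-space
variable of a jointly smooth map depends smoothly on the manifold parameter; Mathlib's
`ContMDiffAt.mfderiv`). [folklore] -/
theorem contMDiff_fibreDeriv : ContMDiff (𝓡 1) 𝓘(ℝ, 𝔼 2 →L[ℝ] 𝔼 2) ∞ (fibreDeriv Φ₁ Φ₂) := by
  intro x₀
  have hf : ContMDiffAt ((𝓡 1).prod 𝓘(ℝ, 𝔼 2)) 𝓘(ℝ, 𝔼 2) ∞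
      (uncurry fun (x : 𝕊 1) (w : 𝔼 2) => (transition Φ₁ Φ₂ (x, w)).2)
      (x₀, (fun _ => (0 : 𝔼 2)) x₀) := by
    have : (uncurry fun (x : 𝕊 1) (w : 𝔼 2) => (transition Φ₁ Φ₂ (x, w)).2) =
        Prod.snd ∘ transition Φ₁ Φ₂ := by
      funext q; rfl
    rw [this]
    exact contMDiffAt_snd.comp _ (contMDiffAt_transition (mem_transitionDom_zero hcore x₀))
  have h := ContMDiffAt.mfderiv (I := 𝓘(ℝ, 𝔼 2)) (I' := 𝓘(ℝ, 𝔼 2)) (J := 𝓡 1) (m := ∞)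
    (fun (x : 𝕊 1) (w : 𝔼 2) => (transition Φ₁ Φ₂ (x, w)).2) (fun _ => (0 : 𝔼 2)) hf
    contMDiffAt_const (by simp)
  rw [inTangentCoordinates_model_space] at h
  refine h.congr_of_eventuallyEq (Filter.Eventually.of_forall fun x => ?_)
  show fibreDeriv Φ₁ Φ₂ x =
    mfderiv 𝓘(ℝ, 𝔼 2) 𝓘(ℝ, 𝔼 2) (fun w : 𝔼 2 => (transition Φ₁ Φ₂ (x, w)).2) 0
  rw [mfderiv_eq_fderiv]
  rfl

end Transition

/-! ### The orthogonal frame of the fibre derivative -/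

section Frame

variable {Φ₁ Φ₂ : CircleTube Y} (hcore : ∀ θ, Φ₁.core θ = Φ₂.core θ)

/-- The first column `A(x) e₀` of the fibre derivative. [folklore] -/
def frameCol (Φ₁ Φ₂ : CircleTube Y) (x : 𝕊 1) : 𝔼 2 := fibreDeriv Φ₁ Φ₂ x planeE0

include hcore in
/-- The first column of the (invertible) fibre derivative is nonzero. [folklore] -/
theorem frameCol_ne_zero (x : 𝕊 1) : frameCol Φ₁ Φ₂ x ≠ 0 := by
  intro h
  have h0 : planeE0 = 0 := injective_fibreDeriv hcore x (by rw [map_zero]; exact h)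
  have := congrArg (fun w : 𝔼 2 => w 0) h0
  simp [planeE0] at this

include hcore in
/-- The first column depends smoothly on the point of the core. [folklore] -/
theorem contMDiff_frameCol : ContMDiff (𝓡 1) 𝓘(ℝ, 𝔼 2) ∞ (frameCol Φ₁ Φ₂) :=
  (contMDiff_fibreDeriv hcore).clm_apply contMDiff_const

/-- The **frame vector** `u(x) = A(x) e₀ / ‖A(x) e₀‖`. [folklore] -/
def frameVec (Φ₁ Φ₂ : CircleTube Y) (x : 𝕊 1) : 𝔼 2 := NormedSpace.normalize (frameCol Φ₁ Φ₂ x)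

include hcore in
/-- The frame vector is a unit vector. [folklore] -/
theorem norm_frameVec (x : 𝕊 1) : ‖frameVec Φ₁ Φ₂ x‖ = 1 :=
  NormedSpace.norm_normalize (frameCol_ne_zero hcore x)

include hcore in
/-- The frame vector depends smoothly on the point of the core. [folklore] -/
theorem contMDiff_frameVec : ContMDiff (𝓡 1) 𝓘(ℝ, 𝔼 2) ∞ (frameVec Φ₁ Φ₂) := by
  have hinv : ContMDiff (𝓡 1) 𝓘(ℝ, ℝ) ∞ fun x => ‖frameCol Φ₁ Φ₂ x‖⁻¹ := by
    intro x
    have h1 : ContDiffAt ℝ ∞ (fun a : 𝔼 2 => ‖a‖⁻¹) (frameCol Φ₁ Φ₂ x) :=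
      (contDiffAt_norm ℝ (frameCol_ne_zero hcore x)).inv
        (norm_ne_zero_iff.2 (frameCol_ne_zero hcore x))
    exact h1.contMDiffAt.comp x (contMDiff_frameCol hcore x)
  exact hinv.smul (contMDiff_frameCol hcore)

include hcore in
/-- The frame vector as a smooth map `S¹ → S¹` (the **rotation field** of the pair `Φ₁`, `Φ₂`).
[folklore] -/
theorem contMDiff_frameUnit :
    ContMDiff (𝓡 1) (𝓡 1) ∞ (fun x => (⟨frameVec Φ₁ Φ₂ x,
      mem_sphere_zero_iff_norm.2 (norm_frameVec hcore x)⟩ : 𝕊 1)) :=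
  (contMDiff_frameVec hcore).codRestrict_sphere _

/-- The **orientation function** `⟪A(x) e₁, J u(x)⟫` (sign of `det A(x)`). [folklore] -/
def frameSign (Φ₁ Φ₂ : CircleTube Y) (x : 𝕊 1) : ℝ :=
  ⟪fibreDeriv Φ₁ Φ₂ x planeE1, quarterTurn (frameVec Φ₁ Φ₂ x)⟫

include hcore in
/-- The orientation function does not vanish. [folklore] -/
theorem frameSign_ne_zero (x : 𝕊 1) : frameSign Φ₁ Φ₂ x ≠ 0 :=
  inner_frame_ne_zero (injective_fibreDeriv hcore x)

include hcore in
/-- The orientation function is continuous. [folklore] -/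
theorem continuous_frameSign : Continuous (frameSign Φ₁ Φ₂) := by
  have h1 : Continuous fun x => fibreDeriv Φ₁ Φ₂ x planeE1 :=
    ((contMDiff_fibreDeriv hcore).clm_apply contMDiff_const).continuous
  have h2 : Continuous fun x => quarterTurn (frameVec Φ₁ Φ₂ x) :=
    contDiff_quarterTurn.continuous.comp (contMDiff_frameVec hcore).continuous
  exact h1.inner h2

include hcore in
/-- **The orientation function has constant sign along the (connected) core**: there is
`s = ±1` with `s ⟪A(x) e₁, J u(x)⟫ > 0` for all `x` (intermediate value theorem; with no
orientation convention both signs occur). [folklore] -/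
theorem exists_frameSign : ∃ s : ℝ, s ^ 2 = 1 ∧ ∀ x, 0 < s * frameSign Φ₁ Φ₂ x := by
  haveI := preconnectedSpace_circle
  have hne := frameSign_ne_zero hcore
  have hc := continuous_frameSign hcore
  set x₀ : 𝕊 1 := circlePoint 0
  -- no sign change
  have hsame : ∀ x, 0 < frameSign Φ₁ Φ₂ x₀ * frameSign Φ₁ Φ₂ x := by
    intro x
    rcases lt_or_gt_of_ne (hne x₀) with h₀ | h₀
    · rcases lt_or_gt_of_ne (hne x) with h | h
      · exact mul_pos_of_neg_of_neg h₀ h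
      · exfalso
        have hmem : (0 : ℝ) ∈ Icc (frameSign Φ₁ Φ₂ x₀) (frameSign Φ₁ Φ₂ x) := ⟨h₀.le, h.le⟩
        obtain ⟨z, hz⟩ := intermediate_value_univ x₀ x hc hmem
        exact hne z hz
    · rcases lt_or_gt_of_ne (hne x) with h | h
      · exfalso
        have hmem : (0 : ℝ) ∈ Icc (frameSign Φ₁ Φ₂ x) (frameSign Φ₁ Φ₂ x₀) := ⟨h.le, h₀.le⟩
        obtain ⟨z, hz⟩ := intermediate_value_univ x x₀ hc hmem
        exact hne z hz
      · exact mul_pos h₀ h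
  rcases lt_or_gt_of_ne (hne x₀) with h₀ | h₀
  · refine ⟨-1, by norm_num, fun x => ?_⟩
    have := hsame x
    nlinarith
  · refine ⟨1, by norm_num, fun x => ?_⟩
    have := hsame x
    nlinarith

variable {s : ℝ} (hs : s ^ 2 = 1)

/-- The **orthogonal frame** `Q(x) = [u(x), s J u(x)]` of the transition map (the orthogonal
factor of the `QR` decomposition of `A(x)`, with the reflection `s = -1` allowed).
[folklore] -/
def tubeFrame (hcore : ∀ θ, Φ₁.core θ = Φ₂.core θ) (hs : s ^ 2 = 1) (x : 𝕊 1) :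
    𝔼 2 ≃ₗᵢ[ℝ] 𝔼 2 :=
  frameIsometry (frameVec Φ₁ Φ₂ x) s (norm_frameVec hcore x) hs

/-- The orthogonal frame, unfolded: `Q(x) w = w₀ u(x) + s w₁ J u(x)`. [folklore] -/
theorem tubeFrame_apply (x : 𝕊 1) (w : 𝔼 2) :
    tubeFrame hcore hs x w = w 0 • frameVec Φ₁ Φ₂ x + (s * w 1) • quarterTurn (frameVec Φ₁ Φ₂ x) := by
  rw [tubeFrame, frameIsometry_apply]

/-- The orthogonal frame is the frame map of the first column. [folklore] -/
theorem tubeFrame_eq_frameMap (x : 𝕊 1) (w : 𝔼 2) :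
    tubeFrame hcore hs x w = frameMap (NormedSpace.normalize (fibreDeriv Φ₁ Φ₂ x planeE0)) s w := by
  rw [tubeFrame_apply, frameMap_apply]
  rfl

/-- **The orthogonal frame depends smoothly on `(x, w)`.** [folklore] -/
theorem contMDiff_tubeFrame :
    ContMDiff I𝕋₁ 𝓘(ℝ, 𝔼 2) ∞ fun p : (𝕊 1) × 𝔼 2 => tubeFrame hcore hs p.1 p.2 := by
  have hcoord : ∀ i : Fin 2, ContMDiff I𝕋₁ 𝓘(ℝ, ℝ) ∞ fun p : (𝕊 1) × 𝔼 2 => p.2 i := fun i =>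
    ((EuclideanSpace.proj (𝕜 := ℝ) i).contDiff.contMDiff).comp contMDiff_snd
  have hu : ContMDiff I𝕋₁ 𝓘(ℝ, 𝔼 2) ∞ fun p : (𝕊 1) × 𝔼 2 => frameVec Φ₁ Φ₂ p.1 :=
    (contMDiff_frameVec hcore).comp contMDiff_fst
  have hJ : ContMDiff I𝕋₁ 𝓘(ℝ, 𝔼 2) ∞ fun p : (𝕊 1) × 𝔼 2 => quarterTurn (frameVec Φ₁ Φ₂ p.1) :=
    contDiff_quarterTurn.comp_contMDiff hu
  have hs1 : ContMDiff I𝕋₁ 𝓘(ℝ, ℝ) ∞ fun p : (𝕊 1) × 𝔼 2 => s * p.2 1 :=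
    contMDiff_const.mul (hcoord 1)
  have h : ContMDiff I𝕋₁ 𝓘(ℝ, 𝔼 2) ∞ fun p : (𝕊 1) × 𝔼 2 =>
      p.2 0 • frameVec Φ₁ Φ₂ p.1 + (s * p.2 1) • quarterTurn (frameVec Φ₁ Φ₂ p.1) :=
    ((hcoord 0).smul hu).add (hs1.smul hJ)
  refine h.congr fun p => ?_
  exact tubeFrame_apply hcore hs p.1 p.2

/-- **The straight line from the fibre derivative to its orthogonal frame stays injective**
(`injective_lineToFrame` along the core, with the sign `s` of the orientation function).
[folklore] -/
theorem injective_line_tubeFrame (hsgn : ∀ x, 0 < s * frameSign Φ₁ Φ₂ x) (x : 𝕊 1) {t : ℝ}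
    (ht : t ∈ Icc (0 : ℝ) 1) :
    Injective fun w : 𝔼 2 => (1 - t) • fibreDeriv Φ₁ Φ₂ x w + t • tubeFrame hcore hs x w := by
  have h := injective_lineToFrame (injective_fibreDeriv hcore x) hs (hsgn x) ht
  intro w w' hww'
  apply h
  show ((1 - t) • fibreDeriv Φ₁ Φ₂ x +
      t • frameMap (NormedSpace.normalize (fibreDeriv Φ₁ Φ₂ x planeE0)) s) w =
    ((1 - t) • fibreDeriv Φ₁ Φ₂ x +
      t • frameMap (NormedSpace.normalize (fibreDeriv Φ₁ Φ₂ x planeE0)) s) w'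
  simp only [add_apply, FunLike.coe_smul, Pi.smul_apply]
  rw [← tubeFrame_eq_frameMap hcore hs, ← tubeFrame_eq_frameMap hcore hs]
  exact hww'

/-- The fibrewise map of the orthogonal frame is smooth. [folklore] -/
theorem contMDiff_circleFibrewiseMap_tubeFrame :
    ContMDiff I𝕋₁ I𝕋₁ ∞ (circleFibrewiseMap (tubeFrame hcore hs)) :=
  contMDiff_circleFibrewiseMap (contMDiff_tubeFrame hcore hs)

end Frame

end CircleTube

end Literature.Topology.FourManifolds

end
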